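import Summits.MatrixMultiplication.MatrixMultiplication.Theorems.ObstructionDescentUniversalOccurrenceThreeColumns

set_option linter.dupNamespace false
set_option autoImplicit false

/-!
# Universal occurrence — cells of the three-column law: `¬UOCC(8, 6)` and `¬UOCC(11, 8)` (route `ObstructionDescent`, kernel K16, part 3 of 3)

Support file for the crux `NoOccurrenceObstruction` (`P_O`, item `stmt-MatrixMultiplication-29040`) of
`Summit.MatrixMultiplication.MatrixMultiplication.Theses.ObstructionDescent`; sequel of `…UniversalOccurrenceThreeColumns`
(the law: a triple with all parts `≤ 3` and `d ≥ 2m + 2` does not occur in `⟨m⟩^{⊗d}`), `…Kronecker` (K-gen 32: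
`UOCC(m,N) ⟺ K(N,N,N) ⊆ S(⟨m⟩)`), `…HookBand` (K10), `…KoszulFive` (K15: `u(N) ≥ 8` for `N ≥ 5`), `…Six` (K12: `u(6) ≤ 14`)
and `…HalfSquare` (`u(N) ≤ ⌈N²/2⌉`).  `UOCC(m, N)` is spelled out literally (no `def`); `u(N)` = the least `m` with `UOCC(m, N)`.

* `not_uocc_of_threeCol`, `cubeBand_of_uocc` — a three-column triple in `K(N,N,N)` of degree `d ≥ 2m+2` refutes `UOCC(m,N)`;
  for the cube `(3ⁿ)³` with `g > 0`: `UOCC(m, N)`, `n ≤ N` force `3n ≤ 2m + 1`.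
* `kronSum_cube_six : kronSum 18 (3⁶)³ = 18!` and `kronSum_cube_eight : kronSum 24 (3⁸)³ = 24!` — `g = 1` in both cases
  (the unique invariants of degree `18` of `ℂ⁶⊗ℂ⁶⊗ℂ⁶` and of degree `24` of `ℂ⁸⊗ℂ⁸⊗ℂ⁸`), by `decide +kernel` on the tree's
  verified Murnaghan–Nakayama evaluator (`kroneckerCoeff_pos_iff_kronSum_pos`).
* **`not_uocc_eight_six : ¬UOCC(8, 6)`**, **`nine_le_of_uocc : 6 ≤ N → UOCC(m, N) → 9 ≤ m`**, `uocc_six_window''`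
  (`UOCC(m,6) → 9 ≤ m`, `14 ≤ m → UOCC(m,6)`); **`not_uocc_eleven_eight : ¬UOCC(11, 8)`**,
  **`twelve_le_of_uocc : 8 ≤ N → UOCC(m, N) → 12 ≤ m`**, `uocc_eight_window` (`UOCC(m,8) → 12 ≤ m`, `32 ≤ m → UOCC(m,8)`).

Ladder of certified rows after this file: `u(2) ≤ 2`; `u(3) = 5`; `u(4) ∈ {6,7}`; `8 ≤ u(5) ≤ 10`; **`9 ≤ u(6) ≤ 14`** (was
`[8,14]`); `10 ≤ u(7) ≤ 19`; **`12 ≤ u(8) ≤ 32`** (was `[10,32]`); `N ≥ 9`: `3⌊(N−1)/2⌋ + 1 ≤ u(N) ≤ ⌈N²/2⌉`.  The cube types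
`(3ⁿ)³` have `g = 1,1,1,1,0,1,1,0` for `n = 3,…,10` (script table, uncertified except `n = 6, 8`); odd `n` only reproduce the hook
band and `n ≥ 10` is outside the Kronecker semigroup (`≤ 9` rows), so rows `6` and `8` are the whole yield of the law for `u`.
Nothing here proves `ω = 2` or decides `P_O`; the cells calibrate the universal-occurrence threshold `u(N)`.

References: P. Bürgisser, C. Ikenmeyer, STOC 2011 / arXiv:1011.1350 [key BurgisserIkenmeyer2011], §3.1–3.2, Lemma 3.2, Lemma 6.1;
P. Bürgisser, C. Ikenmeyer, STOC 2013 [key BurgisserIkenmeyer2013], §4.4; W. Fulton, J. Harris, GTM 129 [key FultonHarrisGTM129],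
Exercise 4.51; T. Lickteig, Linear Algebra Appl. 69 (1985) [key Lickteig1985].
-/

noncomputable section

open scoped BigOperators

namespace Summit.MatrixMultiplication.MatrixMultiplication.Theorems.ObstructionCalculus

open Literature.Computability.AlgebraicComplexity (kroneckerPow isotypicSum₁ isotypicSum₂ isotypicSum₃ unitTensor actTensor triad
  exists_pairing_ne_zero_of_isotypicSum₁₂₃_kroneckerPow_ne_zero card_parts_le_of_isotypicSum₁₂₃_kroneckerPow_ne_zero
  pairing_unitTensor_eq_sum sum_prod_mul_polytabloid_comp_swap sum_prod_mul_polytabloid_eq_zero_of_apply_eq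
  sum_prod_mul_sum_smul_polytabloid exists_sum_smul_polytabloid_eq)
open Literature.NumberTheory.DiophantineGeometry (Word wordRep highestWeightSpace Weight StdFilling ydWeight
  ydWeight_youngDiagram fst_lt_of_mem_youngDiagram kroneckerCoeff)
open Literature.RepresentationTheory.FiniteGroups.MNEval (kronSum kroneckerCoeff_pos_iff_kronSum_pos
  kroneckerCoeff_eq_kronSum_div)

/-! ## §6  Universal-occurrence cells from the three-column law -/

/-- **`¬UOCC(m, N)` from a three-column triple in the Kronecker semigroup.**  If some triple `λ ⊢ d` with all parts
`≤ 3`, at most `N` parts in each partition and `g(λ) > 0` has `d ≥ 2m + 2`, then universal occurrence fails at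
`(m, N)`: by `UOCC(m,N) ⟺ K(N,N,N) ⊆ S(⟨m⟩)` (`uocc_iff_kroneckerSemigroup_le`) the triple would occur in `⟨m⟩^{⊗d}`,
against the three-column law. [cite: BurgisserIkenmeyer2011, §3.1–3.2, Lemma 3.2] -/
theorem not_uocc_of_threeCol {d m N : ℕ} (lam : Fin 3 → Nat.Partition d) (h3 : ∀ j, ∀ a ∈ (lam j).parts, a ≤ 3)
    (hN : ∀ j, (lam j).parts.card ≤ N) (hg : 0 < kroneckerCoeff ℂ (lam 0) (lam 1) (lam 2)) (hdm : 2 * m + 2 ≤ d) :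
    ¬ ∀ {ι : Type} [Fintype ι], Fintype.card ι ≤ N → ∀ (s : ι → ι → ι → ℂ) (d : ℕ)
      (lam : Fin 3 → Nat.Partition d),
      isotypicSum₁ (lam 0) (isotypicSum₂ (lam 1) (isotypicSum₃ (lam 2) (kroneckerPow s d))) ≠ 0 →
      isotypicSum₁ (lam 0) (isotypicSum₂ (lam 1) (isotypicSum₃ (lam 2) (kroneckerPow (unitTensor ℂ m) d))) ≠ 0 :=
  fun hU => (uocc_iff_kroneckerSemigroup_le.1 hU) d lam hN hg
    (isotypicSum_kroneckerPow_unitTensor_eq_zero_of_parts_le_three lam h3 hdm)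

/-- **The cube band `u(N) ≥ ⌈(3n − 1)/2⌉ + 1` whenever `g((3ⁿ),(3ⁿ),(3ⁿ)) > 0` and `n ≤ N`**: with `μ = (3ⁿ) ⊢ 3n`,
`UOCC(m, N)` forces `3n ≤ 2m + 1`.  For even `n` this is `m ≥ 3n/2`, one more than the hook band `3⌊(N−1)/2⌋ + 1` at
`N = n`. [cite: BurgisserIkenmeyer2011, §3.1–3.2] [cite: BurgisserIkenmeyer2013, §4.4] -/
theorem cubeBand_of_uocc {n m N : ℕ} (μ : Nat.Partition (3 * n)) (hμ : μ.sortedParts = List.replicate n 3)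
    (hg : 0 < kroneckerCoeff ℂ μ μ μ) (hN : n ≤ N)
    (hU : ∀ {ι : Type} [Fintype ι], Fintype.card ι ≤ N → ∀ (s : ι → ι → ι → ℂ) (d : ℕ)
      (lam : Fin 3 → Nat.Partition d),
      isotypicSum₁ (lam 0) (isotypicSum₂ (lam 1) (isotypicSum₃ (lam 2) (kroneckerPow s d))) ≠ 0 →
      isotypicSum₁ (lam 0) (isotypicSum₂ (lam 1) (isotypicSum₃ (lam 2) (kroneckerPow (unitTensor ℂ m) d))) ≠ 0) :
    3 * n ≤ 2 * m + 1 := by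
  by_contra hlt
  have h3 : ∀ a ∈ μ.parts, a ≤ 3 := by
    intro a ha
    have ha' : a ∈ μ.sortedParts := by
      unfold Nat.Partition.sortedParts
      exact (Multiset.mem_sort _).2 ha
    rw [hμ] at ha'
    exact (List.eq_of_mem_replicate ha').le
  have hcard : μ.parts.card ≤ N := by
    rw [← μ.length_sortedParts, hμ, List.length_replicate]
    exact hN
  exact not_uocc_of_threeCol (fun _ : Fin 3 => μ) (fun _ => h3) (fun _ => hcard) hg (by omega) hU

set_option maxHeartbeats 100000000 in
set_option maxRecDepth 100000 in
/-- The class sum `Σ_C |C| χ^(3⁶)(C)³ = 18!` over `S₁₈`: **`g((3⁶),(3⁶),(3⁶)) = 1`** (verified Murnaghan–Nakayama evaluator,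
kernel computation). [cite: FultonHarrisGTM129, Exercise 4.51] -/
theorem kronSum_cube_six :
    kronSum 18 [3, 3, 3, 3, 3, 3] [3, 3, 3, 3, 3, 3] [3, 3, 3, 3, 3, 3] = ((18).factorial : ℕ) := by
  decide +kernel

set_option maxHeartbeats 100000000 in
set_option maxRecDepth 100000 in
/-- The class sum `Σ_C |C| χ^(3⁸)(C)³ = 24!` over `S₂₄`: **`g((3⁸),(3⁸),(3⁸)) = 1`** (verified Murnaghan–Nakayama evaluator,
kernel computation). [cite: FultonHarrisGTM129, Exercise 4.51] -/
theorem kronSum_cube_eight :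
    kronSum 24 [3, 3, 3, 3, 3, 3, 3, 3] [3, 3, 3, 3, 3, 3, 3, 3] [3, 3, 3, 3, 3, 3, 3, 3] = ((24).factorial : ℕ) := by
  decide +kernel

/-- **`¬UOCC(8, 6)`: universal occurrence fails for `⟨8⟩` on six letters** — the unique degree-`18` invariant of
`ℂ⁶ ⊗ ℂ⁶ ⊗ ℂ⁶` (type `((3⁶),(3⁶),(3⁶))`, `g = 1`) vanishes on `σ₈` by the three-column law (`2·8 + 2 ≤ 18`) and occurs for
a generic `6 × 6 × 6` tensor.  Sharpens `¬UOCC(7, 6)` (`eight_le_of_uocc`). [cite: BurgisserIkenmeyer2011, §3.1–3.2, Lemma 3.2] -/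
theorem not_uocc_eight_six : ¬ ∀ {ι : Type} [Fintype ι], Fintype.card ι ≤ 6 → ∀ (s : ι → ι → ι → ℂ) (d : ℕ)
      (lam : Fin 3 → Nat.Partition d),
      isotypicSum₁ (lam 0) (isotypicSum₂ (lam 1) (isotypicSum₃ (lam 2) (kroneckerPow s d))) ≠ 0 →
      isotypicSum₁ (lam 0) (isotypicSum₂ (lam 1) (isotypicSum₃ (lam 2) (kroneckerPow (unitTensor ℂ 8) d))) ≠ 0 := by
  intro hU
  have hR : (⟨↑[3, 3, 3, 3, 3, 3], by decide, by decide⟩ : Nat.Partition 18).sortedParts = [3, 3, 3, 3, 3, 3] := by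
    change Multiset.sort _ _ = _; rw [Multiset.coe_sort]; exact List.mergeSort_eq_self _ (by decide)
  have hg : 0 < kroneckerCoeff ℂ (⟨↑[3, 3, 3, 3, 3, 3], by decide, by decide⟩ : Nat.Partition 18)
      ⟨↑[3, 3, 3, 3, 3, 3], by decide, by decide⟩ ⟨↑[3, 3, 3, 3, 3, 3], by decide, by decide⟩ := by
    rw [kroneckerCoeff_pos_iff_kronSum_pos, hR, kronSum_cube_six]
    exact_mod_cast Nat.factorial_pos 18
  have h := cubeBand_of_uocc (n := 6) (N := 6) _ (by rw [hR]; rfl) hg le_rfl hU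
  omega

/-- **`u(N) ≥ 9` for every `N ≥ 6`**: `UOCC(m, N) → 9 ≤ m`.  New ladder window: `9 ≤ u(6) ≤ 14` (`uocc_six_window''`).
[cite: BurgisserIkenmeyer2011, §3.1–3.2] [cite: Lickteig1985] -/
theorem nine_le_of_uocc {m N : ℕ} (hN : 6 ≤ N)
    (hU : ∀ {ι : Type} [Fintype ι], Fintype.card ι ≤ N → ∀ (s : ι → ι → ι → ℂ) (d : ℕ) (lam : Fin 3 → Nat.Partition d),
      isotypicSum₁ (lam 0) (isotypicSum₂ (lam 1) (isotypicSum₃ (lam 2) (kroneckerPow s d))) ≠ 0 →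
      isotypicSum₁ (lam 0) (isotypicSum₂ (lam 1) (isotypicSum₃ (lam 2) (kroneckerPow (unitTensor ℂ m) d))) ≠ 0) : 9 ≤ m := by
  by_contra hlt
  exact not_uocc_eight_six (uocc_mono_format (show m ≤ 8 by omega) (uocc_anti_bound hN hU))

/-- **Row `N = 6` of the universal-occurrence ladder: `9 ≤ u(6) ≤ 14`** — `UOCC(m, 6)` fails for every `m ≤ 8` (three-column
law, this file) and holds for every `m ≥ 14` (generic rank `R_gen(6) = 14`, `uocc_six_of_fourteen_le`).  Previously certified:
`[8, 14]`. [cite: BurgisserIkenmeyer2011, §3.1–3.2] [cite: Lickteig1985] -/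
theorem uocc_six_window'' {m : ℕ} :
    ((∀ {ι : Type} [Fintype ι], Fintype.card ι ≤ 6 → ∀ (s : ι → ι → ι → ℂ) (d : ℕ) (lam : Fin 3 → Nat.Partition d),
      isotypicSum₁ (lam 0) (isotypicSum₂ (lam 1) (isotypicSum₃ (lam 2) (kroneckerPow s d))) ≠ 0 →
      isotypicSum₁ (lam 0) (isotypicSum₂ (lam 1) (isotypicSum₃ (lam 2) (kroneckerPow (unitTensor ℂ m) d))) ≠ 0) → 9 ≤ m) ∧
    (14 ≤ m → ∀ {ι : Type} [Fintype ι], Fintype.card ι ≤ 6 → ∀ (s : ι → ι → ι → ℂ) (d : ℕ) (lam : Fin 3 → Nat.Partition d),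
      isotypicSum₁ (lam 0) (isotypicSum₂ (lam 1) (isotypicSum₃ (lam 2) (kroneckerPow s d))) ≠ 0 →
      isotypicSum₁ (lam 0) (isotypicSum₂ (lam 1) (isotypicSum₃ (lam 2) (kroneckerPow (unitTensor ℂ m) d))) ≠ 0) :=
  ⟨nine_le_of_uocc le_rfl, uocc_six_of_fourteen_le⟩

/-- **`¬UOCC(11, 8)`: universal occurrence fails for `⟨11⟩` on eight letters** — the unique degree-`24` invariant of
`ℂ⁸ ⊗ ℂ⁸ ⊗ ℂ⁸` of type `((3⁸),(3⁸),(3⁸))` (`g = 1`) vanishes on `σ₁₁` (`2·11 + 2 ≤ 24`).  Sharpens the hook-band cell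
`¬UOCC(9, 8)`. [cite: BurgisserIkenmeyer2011, §3.1–3.2, Lemma 3.2] -/
theorem not_uocc_eleven_eight : ¬ ∀ {ι : Type} [Fintype ι], Fintype.card ι ≤ 8 → ∀ (s : ι → ι → ι → ℂ) (d : ℕ)
      (lam : Fin 3 → Nat.Partition d),
      isotypicSum₁ (lam 0) (isotypicSum₂ (lam 1) (isotypicSum₃ (lam 2) (kroneckerPow s d))) ≠ 0 →
      isotypicSum₁ (lam 0) (isotypicSum₂ (lam 1) (isotypicSum₃ (lam 2) (kroneckerPow (unitTensor ℂ 11) d))) ≠ 0 := by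
  intro hU
  have hR : (⟨↑[3, 3, 3, 3, 3, 3, 3, 3], by decide, by decide⟩ : Nat.Partition 24).sortedParts =
      [3, 3, 3, 3, 3, 3, 3, 3] := by
    change Multiset.sort _ _ = _; rw [Multiset.coe_sort]; exact List.mergeSort_eq_self _ (by decide)
  have hg : 0 < kroneckerCoeff ℂ (⟨↑[3, 3, 3, 3, 3, 3, 3, 3], by decide, by decide⟩ : Nat.Partition 24)
      ⟨↑[3, 3, 3, 3, 3, 3, 3, 3], by decide, by decide⟩ ⟨↑[3, 3, 3, 3, 3, 3, 3, 3], by decide, by decide⟩ := by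
    rw [kroneckerCoeff_pos_iff_kronSum_pos, hR, kronSum_cube_eight]
    exact_mod_cast Nat.factorial_pos 24
  have h := cubeBand_of_uocc (n := 8) (N := 8) _ (by rw [hR]; rfl) hg le_rfl hU
  omega

/-- **`u(N) ≥ 12` for every `N ≥ 8`**: `UOCC(m, N) → 12 ≤ m` (previously `10 ≤ m` from the hook band).
[cite: BurgisserIkenmeyer2011, §3.1–3.2] -/
theorem twelve_le_of_uocc {m N : ℕ} (hN : 8 ≤ N)
    (hU : ∀ {ι : Type} [Fintype ι], Fintype.card ι ≤ N → ∀ (s : ι → ι → ι → ℂ) (d : ℕ) (lam : Fin 3 → Nat.Partition d),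
      isotypicSum₁ (lam 0) (isotypicSum₂ (lam 1) (isotypicSum₃ (lam 2) (kroneckerPow s d))) ≠ 0 →
      isotypicSum₁ (lam 0) (isotypicSum₂ (lam 1) (isotypicSum₃ (lam 2) (kroneckerPow (unitTensor ℂ m) d))) ≠ 0) : 12 ≤ m := by
  by_contra hlt
  exact not_uocc_eleven_eight (uocc_mono_format (show m ≤ 11 by omega) (uocc_anti_bound hN hU))

/-- **Row `N = 8` of the universal-occurrence ladder: `12 ≤ u(8) ≤ 32`** — `UOCC(m, 8)` fails for every `m ≤ 11` (three-column
law) and holds for every `m ≥ 32 = ⌈8²/2⌉` (half-square tripod cover, `uocc_of_halfSquare_le`).  Previously certified: `[10, 32]`.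
[cite: BurgisserIkenmeyer2011, §3.1–3.2] -/
theorem uocc_eight_window {m : ℕ} :
    ((∀ {ι : Type} [Fintype ι], Fintype.card ι ≤ 8 → ∀ (s : ι → ι → ι → ℂ) (d : ℕ) (lam : Fin 3 → Nat.Partition d),
      isotypicSum₁ (lam 0) (isotypicSum₂ (lam 1) (isotypicSum₃ (lam 2) (kroneckerPow s d))) ≠ 0 →
      isotypicSum₁ (lam 0) (isotypicSum₂ (lam 1) (isotypicSum₃ (lam 2) (kroneckerPow (unitTensor ℂ m) d))) ≠ 0) → 12 ≤ m) ∧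
    (32 ≤ m → ∀ {ι : Type} [Fintype ι], Fintype.card ι ≤ 8 → ∀ (s : ι → ι → ι → ℂ) (d : ℕ) (lam : Fin 3 → Nat.Partition d),
      isotypicSum₁ (lam 0) (isotypicSum₂ (lam 1) (isotypicSum₃ (lam 2) (kroneckerPow s d))) ≠ 0 →
      isotypicSum₁ (lam 0) (isotypicSum₂ (lam 1) (isotypicSum₃ (lam 2) (kroneckerPow (unitTensor ℂ m) d))) ≠ 0) :=
  ⟨twelve_le_of_uocc le_rfl, fun hm => uocc_of_halfSquare_le (by norm_num) (by norm_num; omega)⟩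

end Summit.MatrixMultiplication.MatrixMultiplication.Theorems.ObstructionCalculus
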